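import Mathlib
import Summits.Parity.GeneralizedHardyLittlewood.Theses.LiouvilleMAD
import Summits.Parity.GeneralizedHardyLittlewood.Theorems.CosetDecorrelation.Negative.CosetDecorrelationWindow

/-!
# The mean/fluctuation split of `CosetDecorrelation` loses exactly its one-point stub (line `SketchIdeator3`)

Glue stub `stub_splitIff` of line `SketchIdeator3` of crux stmt-Parity-13317
(`Summit.Parity.GeneralizedHardyLittlewood.Theses.LiouvilleMAD.CosetDecorrelation`, card
`farey-level-mean-coupling`), registered by the continuation lead c2 so that the line's sorry-free
composition and honesty theorems become importable by name (they previously lived only in the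
sorry-bearing skeleton `Cruxes/CosetDecorrelation/Lines/SketchIdeator3.lean`). [folklore]

Write `T_j(n,n') = Σ_{(m,m') ∈ (M,2M]², m ≡ m' (mod j)} λ(mn+c) λ(m'n'+c)` (the crux's coset sum) and
`S(n) = Σ_{m ∈ (M,2M]} λ(mn+c)`.  The line splits `T_j = (T_j − S(n)S(n')/j) + S(n)S(n')/j` and files

* K1 (`MeanCorrectedCosetDecorrelation`, the residual): `|T_j − S(n)S(n')/j| ≤ C·M^{3/4+ϑ}`, `ϑ < 1/4`,
  on the crux's ranges;
* K2 (`ProgressionMeanPowerSaving`, one-point): `|S(n)| ≤ C·M^{3/4−κ/2}` for all `1 ≤ n ≤ 2M`, some `κ > 0`.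

**What is proved (all statements def-free, in the route's vocabulary).**
* `split_levelOne_le`: `|S| , |S'| ≤ C M^{3/4−κ/2}`, `M ≥ 1`, `j ≥ ⌊√M⌋+1` ⟹ `|S S'/j| ≤ C² M^{1−κ}`
  (because `j > √M`).
* `cosetDecorrelation_of_split`: K2 → K1 → `CosetDecorrelation` (triangle inequality; exponent
  `ϑ := max ϑ₁ (1/4 − κ) < 1/4`, constant `max C₁ 0 + C₂²`).
* `meanCorrected_of_cosetDecorrelation_split`: `CosetDecorrelation` → K2 → K1 (same bookkeeping).
* `stub_splitIff` (REGISTERED glue stub): `(K1 ∧ K2) ↔ (CosetDecorrelation ∧ K2)` — modulo the one-point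
  stub the residual K1 is EQUIVALENT to the crux: the split relocates the difficulty, it does not reduce it.
-/

namespace Summit.Parity.GeneralizedHardyLittlewood.Theorems.CosetDecorrelation.FareyLevelMeanCoupling

open Finset
open Summit.Parity.GeneralizedHardyLittlewood.Theses.LiouvilleMAD (CosetDecorrelation)
open Summit.Parity.GeneralizedHardyLittlewood.Theorems.CosetDecorrelation.Negative (sqrt_lt_natSqrt_add_one)

/-- Level-1 bookkeeping: if `|S| ≤ C M^{3/4−κ/2}` and `|S'| ≤ C M^{3/4−κ/2}` with `M ≥ 1` and
`j ≥ ⌊√M⌋+1 (> √M)`, then `|S·S'/j| ≤ C² · M^{1−κ}`. -/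
theorem split_levelOne_le {S S' C κ : ℝ} {M j : ℕ} (hM : 1 ≤ M) (hj : Nat.sqrt M + 1 ≤ j)
    (hS : |S| ≤ C * (M : ℝ) ^ (3 / 4 - κ / 2)) (hS' : |S'| ≤ C * (M : ℝ) ^ (3 / 4 - κ / 2)) :
    |S * S' / (j : ℝ)| ≤ C ^ 2 * (M : ℝ) ^ (1 - κ) := by
  have hMpos : (0 : ℝ) < M := by exact_mod_cast hM
  have hjpos : (0 : ℝ) < j := by
    have : 1 ≤ j := le_trans (Nat.succ_le_succ (Nat.zero_le _)) hj
    exact_mod_cast this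
  have hsqrt_le_j : Real.sqrt M ≤ (j : ℝ) := by
    have h1 := sqrt_lt_natSqrt_add_one M
    have h2 : ((Nat.sqrt M + 1 : ℕ) : ℝ) ≤ j := by exact_mod_cast hj
    linarith
  have hsqrt_pos : 0 < Real.sqrt M := Real.sqrt_pos.mpr hMpos
  have hC : 0 ≤ C * (M : ℝ) ^ (3 / 4 - κ / 2) := (abs_nonneg _).trans hS
  -- |S S'| ≤ (C M^e)^2
  have hprod : |S * S'| ≤ (C * (M : ℝ) ^ (3 / 4 - κ / 2)) ^ 2 := by
    rw [abs_mul, sq]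
    exact mul_le_mul hS hS' (abs_nonneg _) hC
  -- (C M^e)^2 = C^2 M^{3/2 - κ}
  have hsq : (C * (M : ℝ) ^ (3 / 4 - κ / 2)) ^ 2 = C ^ 2 * (M : ℝ) ^ (3 / 2 - κ) := by
    rw [mul_pow, ← Real.rpow_natCast ((M : ℝ) ^ (3 / 4 - κ / 2)) 2, ← Real.rpow_mul hMpos.le]
    norm_num
    left
    ring_nf
  -- M^{3/2-κ} / √M = M^{1-κ}
  have hdiv : (M : ℝ) ^ (3 / 2 - κ) / Real.sqrt M = (M : ℝ) ^ (1 - κ) := by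
    rw [Real.sqrt_eq_rpow, ← Real.rpow_sub hMpos, show (3 / 2 - κ - 1 / 2 : ℝ) = 1 - κ by ring]
  rw [abs_div, Nat.abs_cast]
  calc |S * S'| / (j : ℝ)
      ≤ (C * (M : ℝ) ^ (3 / 4 - κ / 2)) ^ 2 / (j : ℝ) :=
        div_le_div_of_nonneg_right hprod hjpos.le
    _ ≤ (C * (M : ℝ) ^ (3 / 4 - κ / 2)) ^ 2 / Real.sqrt M :=
        div_le_div_of_nonneg_left (sq_nonneg _) hsqrt_pos hsqrt_le_j
    _ = C ^ 2 * (M : ℝ) ^ (1 - κ) := by rw [hsq, mul_div_assoc, hdiv]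

/-- **Composition of the line** (K2 → K1 → crux): the one-point power saving along the progressions
`c mod n` (K2) and the mean-corrected coset decorrelation (K1) give `CosetDecorrelation`, with
`ϑ := max ϑ₁ (1/4 − κ) < 1/4` and `C := max C₁ 0 + C₂²` — triangle inequality
`|T_j| ≤ |T_j − S S'/j| + |S S'/j|` and `split_levelOne_le`. -/
theorem cosetDecorrelation_of_split
    (h2 : ∀ c : ℤ, c ≠ 0 → ∃ κ : ℝ, 0 < κ ∧ ∃ C : ℝ, ∀ M n : ℕ, 1 ≤ n → n ≤ 2 * M →
      |∑ m ∈ Finset.Ioc M (2 * M), (ArithmeticFunction.liouville (Int.toNat ((m : ℤ) * n + c)) : ℝ)|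
        ≤ C * (M : ℝ) ^ (3 / 4 - κ / 2))
    (h1 : ∀ c : ℤ, c ≠ 0 → ∃ ϑ : ℝ, ϑ < 1 / 4 ∧ ∃ C : ℝ, ∀ M n n' j : ℕ, 1 ≤ n → 1 ≤ n' → n ≠ n' →
      n ≤ 2 * M → n' ≤ 2 * M → Nat.sqrt M + 1 ≤ j → j < 2 * (Nat.sqrt M + 1) →
        |(∑ p ∈ (Finset.Ioc M (2 * M) ×ˢ Finset.Ioc M (2 * M)).filter
              (fun p : ℕ × ℕ => p.1 ≡ p.2 [MOD j]),
            (ArithmeticFunction.liouville (Int.toNat ((p.1 : ℤ) * n + c)) : ℝ) *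
              (ArithmeticFunction.liouville (Int.toNat ((p.2 : ℤ) * n' + c)) : ℝ))
          - (∑ m ∈ Finset.Ioc M (2 * M), (ArithmeticFunction.liouville (Int.toNat ((m : ℤ) * n + c)) : ℝ)) *
              (∑ m ∈ Finset.Ioc M (2 * M), (ArithmeticFunction.liouville (Int.toNat ((m : ℤ) * n' + c)) : ℝ)) /
                (j : ℝ)|
          ≤ C * (M : ℝ) ^ (3 / 4 + ϑ)) :
    CosetDecorrelation := by
  intro c hc
  obtain ⟨κ, hκ, C₂, hS⟩ := h2 c hc
  obtain ⟨ϑ₁, hϑ₁, C₁, hT⟩ := h1 c hc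
  refine ⟨max ϑ₁ (1 / 4 - κ), max_lt hϑ₁ (by linarith), max C₁ 0 + C₂ ^ 2, ?_⟩
  intro M n n' j hn hn' hne hnM hn'M hj1 hj2
  have hM : 1 ≤ M := by omega
  have hMr : (1 : ℝ) ≤ M := by exact_mod_cast hM
  have hMpos : (0 : ℝ) < M := by linarith
  -- the three pieces
  set T : ℝ := ∑ p ∈ (Finset.Ioc M (2 * M) ×ˢ Finset.Ioc M (2 * M)).filter
      (fun p : ℕ × ℕ => p.1 ≡ p.2 [MOD j]),
    (ArithmeticFunction.liouville (Int.toNat ((p.1 : ℤ) * n + c)) : ℝ) *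
      (ArithmeticFunction.liouville (Int.toNat ((p.2 : ℤ) * n' + c)) : ℝ) with hTdef
  set S : ℝ := ∑ m ∈ Finset.Ioc M (2 * M),
    (ArithmeticFunction.liouville (Int.toNat ((m : ℤ) * n + c)) : ℝ) with hSdef
  set S' : ℝ := ∑ m ∈ Finset.Ioc M (2 * M),
    (ArithmeticFunction.liouville (Int.toNat ((m : ℤ) * n' + c)) : ℝ) with hS'def
  have e1 : |T - S * S' / (j : ℝ)| ≤ C₁ * (M : ℝ) ^ (3 / 4 + ϑ₁) :=
    hT M n n' j hn hn' hne hnM hn'M hj1 hj2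
  have e2 : |S * S' / (j : ℝ)| ≤ C₂ ^ 2 * (M : ℝ) ^ (1 - κ) :=
    split_levelOne_le hM hj1 (hS M n hn hnM) (hS M n' hn' hn'M)
  -- monotonicity in the exponent (M ≥ 1)
  have m1 : (M : ℝ) ^ (3 / 4 + ϑ₁) ≤ (M : ℝ) ^ (3 / 4 + max ϑ₁ (1 / 4 - κ)) :=
    Real.rpow_le_rpow_of_exponent_le hMr (by linarith [le_max_left ϑ₁ (1 / 4 - κ)])
  have m2 : (M : ℝ) ^ (1 - κ) ≤ (M : ℝ) ^ (3 / 4 + max ϑ₁ (1 / 4 - κ)) :=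
    Real.rpow_le_rpow_of_exponent_le hMr (by linarith [le_max_right ϑ₁ (1 / 4 - κ)])
  have hpow₁ : 0 ≤ (M : ℝ) ^ (3 / 4 + ϑ₁) := Real.rpow_nonneg hMpos.le _
  have e1' : |T - S * S' / (j : ℝ)| ≤ max C₁ 0 * (M : ℝ) ^ (3 / 4 + max ϑ₁ (1 / 4 - κ)) :=
    calc |T - S * S' / (j : ℝ)| ≤ C₁ * (M : ℝ) ^ (3 / 4 + ϑ₁) := e1
      _ ≤ max C₁ 0 * (M : ℝ) ^ (3 / 4 + ϑ₁) :=
          mul_le_mul_of_nonneg_right (le_max_left _ _) hpow₁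
      _ ≤ max C₁ 0 * (M : ℝ) ^ (3 / 4 + max ϑ₁ (1 / 4 - κ)) :=
          mul_le_mul_of_nonneg_left m1 (le_max_right _ _)
  have e2' : |S * S' / (j : ℝ)| ≤ C₂ ^ 2 * (M : ℝ) ^ (3 / 4 + max ϑ₁ (1 / 4 - κ)) :=
    e2.trans (mul_le_mul_of_nonneg_left m2 (sq_nonneg _))
  have hsplit : T = (T - S * S' / (j : ℝ)) + S * S' / (j : ℝ) := by ring
  calc |T| = |(T - S * S' / (j : ℝ)) + S * S' / (j : ℝ)| := by rw [← hsplit]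
    _ ≤ |T - S * S' / (j : ℝ)| + |S * S' / (j : ℝ)| := abs_add_le _ _
    _ ≤ max C₁ 0 * (M : ℝ) ^ (3 / 4 + max ϑ₁ (1 / 4 - κ)) +
          C₂ ^ 2 * (M : ℝ) ^ (3 / 4 + max ϑ₁ (1 / 4 - κ)) := add_le_add e1' e2'
    _ = (max C₁ 0 + C₂ ^ 2) * (M : ℝ) ^ (3 / 4 + max ϑ₁ (1 / 4 - κ)) := by ring

/-- **Honesty of the split** (crux → K2 → K1): conversely the crux and the one-point stub give the
residual K1, by `|T_j − S S'/j| ≤ |T_j| + |S S'/j|` and the same bookkeeping. -/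
theorem meanCorrected_of_cosetDecorrelation_split (hC : CosetDecorrelation)
    (h2 : ∀ c : ℤ, c ≠ 0 → ∃ κ : ℝ, 0 < κ ∧ ∃ C : ℝ, ∀ M n : ℕ, 1 ≤ n → n ≤ 2 * M →
      |∑ m ∈ Finset.Ioc M (2 * M), (ArithmeticFunction.liouville (Int.toNat ((m : ℤ) * n + c)) : ℝ)|
        ≤ C * (M : ℝ) ^ (3 / 4 - κ / 2)) :
    ∀ c : ℤ, c ≠ 0 → ∃ ϑ : ℝ, ϑ < 1 / 4 ∧ ∃ C : ℝ, ∀ M n n' j : ℕ, 1 ≤ n → 1 ≤ n' → n ≠ n' →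
      n ≤ 2 * M → n' ≤ 2 * M → Nat.sqrt M + 1 ≤ j → j < 2 * (Nat.sqrt M + 1) →
        |(∑ p ∈ (Finset.Ioc M (2 * M) ×ˢ Finset.Ioc M (2 * M)).filter
              (fun p : ℕ × ℕ => p.1 ≡ p.2 [MOD j]),
            (ArithmeticFunction.liouville (Int.toNat ((p.1 : ℤ) * n + c)) : ℝ) *
              (ArithmeticFunction.liouville (Int.toNat ((p.2 : ℤ) * n' + c)) : ℝ))
          - (∑ m ∈ Finset.Ioc M (2 * M), (ArithmeticFunction.liouville (Int.toNat ((m : ℤ) * n + c)) : ℝ)) *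
              (∑ m ∈ Finset.Ioc M (2 * M), (ArithmeticFunction.liouville (Int.toNat ((m : ℤ) * n' + c)) : ℝ)) /
                (j : ℝ)|
          ≤ C * (M : ℝ) ^ (3 / 4 + ϑ) := by
  intro c hc
  obtain ⟨κ, hκ, C₂, hS⟩ := h2 c hc
  obtain ⟨ϑ₁, hϑ₁, C₁, hT⟩ := hC c hc
  refine ⟨max ϑ₁ (1 / 4 - κ), max_lt hϑ₁ (by linarith), max C₁ 0 + C₂ ^ 2, ?_⟩
  intro M n n' j hn hn' hne hnM hn'M hj1 hj2
  have hM : 1 ≤ M := by omega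
  have hMr : (1 : ℝ) ≤ M := by exact_mod_cast hM
  have hMpos : (0 : ℝ) < M := by linarith
  set T : ℝ := ∑ p ∈ (Finset.Ioc M (2 * M) ×ˢ Finset.Ioc M (2 * M)).filter
      (fun p : ℕ × ℕ => p.1 ≡ p.2 [MOD j]),
    (ArithmeticFunction.liouville (Int.toNat ((p.1 : ℤ) * n + c)) : ℝ) *
      (ArithmeticFunction.liouville (Int.toNat ((p.2 : ℤ) * n' + c)) : ℝ) with hTdef
  set S : ℝ := ∑ m ∈ Finset.Ioc M (2 * M),
    (ArithmeticFunction.liouville (Int.toNat ((m : ℤ) * n + c)) : ℝ) with hSdef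
  set S' : ℝ := ∑ m ∈ Finset.Ioc M (2 * M),
    (ArithmeticFunction.liouville (Int.toNat ((m : ℤ) * n' + c)) : ℝ) with hS'def
  have e1 : |T| ≤ C₁ * (M : ℝ) ^ (3 / 4 + ϑ₁) := hT M n n' j hn hn' hne hnM hn'M hj1 hj2
  have e2 : |S * S' / (j : ℝ)| ≤ C₂ ^ 2 * (M : ℝ) ^ (1 - κ) :=
    split_levelOne_le hM hj1 (hS M n hn hnM) (hS M n' hn' hn'M)
  have m1 : (M : ℝ) ^ (3 / 4 + ϑ₁) ≤ (M : ℝ) ^ (3 / 4 + max ϑ₁ (1 / 4 - κ)) :=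
    Real.rpow_le_rpow_of_exponent_le hMr (by linarith [le_max_left ϑ₁ (1 / 4 - κ)])
  have m2 : (M : ℝ) ^ (1 - κ) ≤ (M : ℝ) ^ (3 / 4 + max ϑ₁ (1 / 4 - κ)) :=
    Real.rpow_le_rpow_of_exponent_le hMr (by linarith [le_max_right ϑ₁ (1 / 4 - κ)])
  have hpow₁ : 0 ≤ (M : ℝ) ^ (3 / 4 + ϑ₁) := Real.rpow_nonneg hMpos.le _
  have e1' : |T| ≤ max C₁ 0 * (M : ℝ) ^ (3 / 4 + max ϑ₁ (1 / 4 - κ)) :=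
    calc |T| ≤ C₁ * (M : ℝ) ^ (3 / 4 + ϑ₁) := e1
      _ ≤ max C₁ 0 * (M : ℝ) ^ (3 / 4 + ϑ₁) :=
          mul_le_mul_of_nonneg_right (le_max_left _ _) hpow₁
      _ ≤ max C₁ 0 * (M : ℝ) ^ (3 / 4 + max ϑ₁ (1 / 4 - κ)) :=
          mul_le_mul_of_nonneg_left m1 (le_max_right _ _)
  have e2' : |S * S' / (j : ℝ)| ≤ C₂ ^ 2 * (M : ℝ) ^ (3 / 4 + max ϑ₁ (1 / 4 - κ)) :=
    e2.trans (mul_le_mul_of_nonneg_left m2 (sq_nonneg _))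
  calc |T - S * S' / (j : ℝ)| ≤ |T| + |S * S' / (j : ℝ)| := abs_sub _ _
    _ ≤ max C₁ 0 * (M : ℝ) ^ (3 / 4 + max ϑ₁ (1 / 4 - κ)) +
          C₂ ^ 2 * (M : ℝ) ^ (3 / 4 + max ϑ₁ (1 / 4 - κ)) := add_le_add e1' e2'
    _ = (max C₁ 0 + C₂ ^ 2) * (M : ℝ) ^ (3 / 4 + max ϑ₁ (1 / 4 - κ)) := by ring

/-- **STUB `stub_splitIff`** (registered glue stub of line `SketchIdeator3`, crux stmt-Parity-13317):
the mean/fluctuation split is lossless MODULO its one-point stub — `(K1 ∧ K2) ↔ (CosetDecorrelation ∧ K2)`.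
In words: given the one-point power saving K2, the line's residual K1 (mean-corrected coset
decorrelation) is equivalent to the crux itself; the split moves the level-1 term `S(n)S(n')/j` out
and nothing else. -/
theorem stub_splitIff :
    ((∀ c : ℤ, c ≠ 0 → ∃ ϑ : ℝ, ϑ < 1 / 4 ∧ ∃ C : ℝ, ∀ M n n' j : ℕ, 1 ≤ n → 1 ≤ n' → n ≠ n' →
      n ≤ 2 * M → n' ≤ 2 * M → Nat.sqrt M + 1 ≤ j → j < 2 * (Nat.sqrt M + 1) →
        |(∑ p ∈ (Finset.Ioc M (2 * M) ×ˢ Finset.Ioc M (2 * M)).filter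
              (fun p : ℕ × ℕ => p.1 ≡ p.2 [MOD j]),
            (ArithmeticFunction.liouville (Int.toNat ((p.1 : ℤ) * n + c)) : ℝ) *
              (ArithmeticFunction.liouville (Int.toNat ((p.2 : ℤ) * n' + c)) : ℝ))
          - (∑ m ∈ Finset.Ioc M (2 * M), (ArithmeticFunction.liouville (Int.toNat ((m : ℤ) * n + c)) : ℝ)) *
              (∑ m ∈ Finset.Ioc M (2 * M), (ArithmeticFunction.liouville (Int.toNat ((m : ℤ) * n' + c)) : ℝ)) /
                (j : ℝ)|
          ≤ C * (M : ℝ) ^ (3 / 4 + ϑ)) ∧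
     (∀ c : ℤ, c ≠ 0 → ∃ κ : ℝ, 0 < κ ∧ ∃ C : ℝ, ∀ M n : ℕ, 1 ≤ n → n ≤ 2 * M →
      |∑ m ∈ Finset.Ioc M (2 * M), (ArithmeticFunction.liouville (Int.toNat ((m : ℤ) * n + c)) : ℝ)|
        ≤ C * (M : ℝ) ^ (3 / 4 - κ / 2))) ↔
    (Summit.Parity.GeneralizedHardyLittlewood.Theses.LiouvilleMAD.CosetDecorrelation ∧
     (∀ c : ℤ, c ≠ 0 → ∃ κ : ℝ, 0 < κ ∧ ∃ C : ℝ, ∀ M n : ℕ, 1 ≤ n → n ≤ 2 * M →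
      |∑ m ∈ Finset.Ioc M (2 * M), (ArithmeticFunction.liouville (Int.toNat ((m : ℤ) * n + c)) : ℝ)|
        ≤ C * (M : ℝ) ^ (3 / 4 - κ / 2))) :=
  ⟨fun h => ⟨cosetDecorrelation_of_split h.2 h.1, h.2⟩,
   fun h => ⟨meanCorrected_of_cosetDecorrelation_split h.1 h.2, h.2⟩⟩

end Summit.Parity.GeneralizedHardyLittlewood.Theorems.CosetDecorrelation.FareyLevelMeanCoupling
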